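import Mathlib
import Summits.Ventures.PercRepro2.SwOutMultiRootEBase
import Summits.Ventures.PercRepro2.SwOutMultiRootThm

/-!
# THE MULTI-ROOT CORE CUBE THEOREM WITH ROOT–ROOT EDGES (blind cell PercRepro2, night-4 g34,
2026-08-29; proofs/NIGHT4-G34.md §8)

`rigidOK_g_of_multiRoot` (SwOutMultiRootThm) for a root set `R ∋ h` whose roots MAY be joined by
edges (several edges `h–u`, adjacent junctions): no subdivision, the root–root edges are cube
coordinates.  Hypotheses: `l ∉ U`, `h ∈ R`, no loop at a root, every other vertex of `U` exempt
(forced into `C_R(l)`), in `X` (loops only; `X` avoids `R`), with an outside edge, or isolated: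
**`rigidOK_g_of_multiRootE`** — the rigid counting inequality on the NON-ESCAPING part of the
general doubly typed side of every class `(U, ξ)`.
-/

namespace Summit.Ventures.PercRepro2

namespace LocRows

open Hull

variable {V : Type*} {E : Type*} [Fintype E] [DecidableEq E]

open scoped Classical

variable {ends : E → Sym2 V} {U : Set V} {ξ : Config E} {l h : V}
  {𝓤 𝓓 𝓓'' : Set (Set V)} {X : Set V} {𝓤' : Set (Set V)} {F : V → Prop}

section Main

variable {R : Set V}
  (h𝓤 : IsUpperSet 𝓤) (h𝓓 : IsLowerSet 𝓓) (h𝓓'' : IsLowerSet 𝓓'') (h𝓤' : IsUpperSet 𝓤')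
  (hl : l ∉ U) (hh : h ∈ R)
  (hloop : ∀ e r, r ∈ R → ends e ≠ s(r, r))
  (hF : ∀ x, F x → ∀ S ∈ 𝓤, x ∈ S)
  (hout : ∀ x ∈ U, x ∉ R →
    F x ∨ x ∈ X ∨ (∃ e y, ends e = s(x, y) ∧ y ∉ U) ∨ (∀ e, x ∉ ends e))
  (hX : ∀ x ∈ X, x ∈ U → ∀ e, x ∈ ends e → ends e = s(x, x))
  (hRX : ∀ r ∈ R, r ∉ X)
include hl hh hloop hF hout hX

/-- The base with root–root edges of a non-escaping side point lies in the class. -/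
lemma baseRR_mem_outClass {ζ : Config E} (hζ : ζ ∈ gOutSide ends l h 𝓤 𝓓 𝓓'' X 𝓤' U ξ)
    (hne : ∀ r ∈ R, hull ends ζ r ⊆ U) : baseRR ends R ζ ∈ outClass ends U h ξ := by
  have hb := multiBaseE_baseRR hl hloop hF hout hX hζ hne
  have hcl := (mem_gOutSide.1 hζ).2
  rw [mem_outClass] at hcl ⊢
  refine ⟨fun e he => ?_, ?_⟩
  · rw [← hcl.1 e he]
    have hrr : e ∉ rrEdges ends R := by
      intro hrr
      obtain ⟨r, hr, r', -, hrr'⟩ := mem_rrEdges.1 hrr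
      exact he ⟨r, extHullR_subset_U hne (mem_extHullR_of_mem hr), r', hrr'⟩
    rw [baseRR_apply_of_notMem hrr]
    unfold baseR
    rw [flip_apply_of_notMem]
    rintro ⟨x, hx, y, hxy⟩
    exact he ⟨x, extHullR_subset_U hne (bluePartR_subset hx), y, hxy⟩
  · have := hb.hull_subset (fun _ => true) hh
    rw [MultiBaseE.coreRealRR_top] at this
    exact this.trans (extHullR_subset_U hne)

include h𝓤 h𝓓 h𝓓'' h𝓤' hRX in
/-- **THE MULTI-ROOT CORE CUBE THEOREM WITH ROOT–ROOT EDGES**: the rigid counting inequality on the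
NON-ESCAPING part of the general doubly typed side of every class of a region with the roots
`R ∋ h` (edges between roots allowed). -/
theorem rigidOK_g_of_multiRootE {𝓔 : Set (Set E)} (h𝓔 : IsUpperSet 𝓔) :
    ((gOutSide ends l h 𝓤 𝓓 𝓓'' X 𝓤' U ξ).filter fun ζ =>
        (∀ r ∈ R, hull ends ζ r ⊆ U) ∧ redEdges ends ζ h ∈ 𝓔).card ≤
      ((gOutSide ends l h 𝓤 𝓓 𝓓'' X 𝓤' U ξ).filter fun ζ =>
        (∀ r ∈ R, hull ends ζ r ⊆ U) ∧ blueEdges ends ζ h ∈ 𝓔).card := by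
  refine rigidOK_g_of_blocks_part (fun ζ => (baseRR ends R ζ, armsR ends R ζ))
    (fun p => coreCubeRR ends (armsFun p.2) (rrEdges ends R) p.1)
    (fun ζ => ∀ r ∈ R, hull ends ζ r ⊆ U) ?_ ?_ ?_ h𝓔
  · intro ζ hζ hne
    exact mem_coreCubeRR.2 ⟨omegaRR ends R ζ, coreRealRR_baseRR_omegaRR hl hF hout hX hζ hne⟩
  · intro ζ hζ hne ζ' hζ' hQ
    have hb := multiBaseE_baseRR hl hloop hF hout hX hζ hne
    obtain ⟨ω, rfl⟩ := mem_coreCubeRR.1 hζ'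
    have hHU : extHullR ends R ζ ⊆ U := extHullR_subset_U hne
    have hH : extHullR ends R (baseRR ends R ζ) = extHullR ends R ζ := by
      have := hb.extHullR_coreRealRR (fun _ => true)
      rwa [MultiBaseE.coreRealRR_top] at this
    refine ⟨mem_gOutSide.2 ⟨hQ, hb.coreRealRR_mem_outClass hh hHU
      (baseRR_mem_outClass hl hh hloop hF hout hX hζ hne) ω⟩,
      fun r hr => hb.hull_coreRealRR_subset_U hHU ω hr, ?_⟩
    simp only
    rw [hb.baseRR_coreRealRR rfl ω, hb.armsR_coreRealRR ω hH, armsR_congr hH]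
  · intro ζ hζ hne 𝓔' h𝓔'
    have hb := multiBaseE_baseRR hl hloop hF hout hX hζ hne
    exact hb.card_coreCubeRR_le_g hh h𝓤 h𝓓 h𝓓'' h𝓤' (extHullR_subset_U hne) hl
      (fun x hx => X_notMem_extHullR hRX hne hX hx) h𝓔'

end Main

end LocRows

end Summit.Ventures.PercRepro2
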